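import Mathlib
import HarnessLib
import Literature.Analysis.FluidPDE.SingularKernelGradient

/-!
# Crux `IsobarTomography.BlobRiccatiClosure` (stmt-NavierStokesRegularity-11740), line
# `type-i-apex-liouville` — scale-`R` bounds for the cutoff `χ_R = suppCutoff x₀ R`

Helper file (theorems only) `--supports` the item (registered stub `stub_cutoffTools`). The
div–curl tomography of the velocity gradient behind the apex scale floor localises fields with
the standard cutoff `χ_R = suppCutoff x₀ R` of the tree (`SingularKernelGradient`): smooth, `= 1`
on `B̄(x₀, R)`, `= 0` off `B(x₀, 2R)`. This file records its quantitative calculus at scale `R`: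
`‖∇χ_R‖ ≤ c₁/R`, `χ_R` is `(c₁/R)`-Lipschitz, `∇χ_R` is `(c₂/R²)`-Lipschitz, both for the Fréchet
derivative and for the Riesz-represented `gradient`, with universal constants `c₁, c₂`. The
argument is the one of the tree's `exists_norm_fderiv_radialCutoff_le`, run one order higher:
at the unit scale `θ₁ = radialCutoff 1 2` is smooth with compact support, so `∇θ₁` and `∇²θ₁`
are bounded, whence `∇θ₁` is Lipschitz by the mean value inequality; then
`χ_R(y) = θ₁(R⁻¹(y − x₀))` and the chain rule give `∇χ_R(y) = R⁻¹ ∇θ₁(R⁻¹(y − x₀))`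
(Gilbarg–Trudinger, *Elliptic PDE of Second Order*, §4.1, the cutoff `η` with
`|Dη| ≤ C/R`, `|D²η| ≤ C/R²`).
-/

noncomputable section

open Set

-- the summit and its single sub-problem share the name (CONVENTIONS §1), as in every Theorems file
set_option linter.dupNamespace false

namespace Summit.NavierStokesRegularity.NavierStokesRegularity.Theorems.BlobRiccatiClosure.TypeIApexLiouville

open Literature.Analysis Literature.Analysis.FluidPDE

/-- **Unit-scale bounds**: for `θ₁ = radialCutoff 1 2` on `ℝ³` there are `B₁, B₂ ≥ 0` with
`‖∇θ₁‖ ≤ B₁` and `‖∇θ₁(w) − ∇θ₁(w')‖ ≤ B₂ ‖w − w'‖` (continuity and compact support of `∇θ₁`,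
`∇²θ₁`, and the mean value inequality on the whole space). [folklore] -/
theorem cutoffTools_unitBounds :
    ∃ B₁ B₂ : ℝ, 0 ≤ B₁ ∧ 0 ≤ B₂ ∧
      (∀ w : EuclideanSpace ℝ (Fin 3),
        ‖fderiv ℝ (radialCutoff 1 2 : EuclideanSpace ℝ (Fin 3) → ℝ) w‖ ≤ B₁) ∧
      (∀ w w' : EuclideanSpace ℝ (Fin 3),
        ‖fderiv ℝ (radialCutoff 1 2 : EuclideanSpace ℝ (Fin 3) → ℝ) w -
            fderiv ℝ (radialCutoff 1 2 : EuclideanSpace ℝ (Fin 3) → ℝ) w'‖ ≤ B₂ * ‖w - w'‖) := by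
  have hsupp : HasCompactSupport (radialCutoff 1 2 : EuclideanSpace ℝ (Fin 3) → ℝ) :=
    hasCompactSupport_radialCutoff (E := EuclideanSpace ℝ (Fin 3)) zero_le_one one_lt_two
  -- first derivative: continuous with compact support, hence bounded
  have hsm₁ : ContDiff ℝ 1 (radialCutoff 1 2 : EuclideanSpace ℝ (Fin 3) → ℝ) :=
    radialCutoff_contDiff 1 2
  obtain ⟨B₁, hB₁⟩ :=
    (hsm₁.continuous_fderiv one_ne_zero).bounded_above_of_compact_support (hsupp.fderiv (𝕜 := ℝ))
  -- second derivative, through the iterated derivative (a continuous bilinear map)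
  have hsm₂ : ContDiff ℝ 2 (radialCutoff 1 2 : EuclideanSpace ℝ (Fin 3) → ℝ) :=
    radialCutoff_contDiff 1 2
  obtain ⟨B₂, hB₂⟩ :=
    hsm₂.continuous_iteratedFDeriv'.bounded_above_of_compact_support (hsupp.iteratedFDeriv 2)
  have hB₂' : ∀ w : EuclideanSpace ℝ (Fin 3),
      ‖fderiv ℝ (fderiv ℝ (radialCutoff 1 2 : EuclideanSpace ℝ (Fin 3) → ℝ)) w‖ ≤ B₂ := by
    intro w
    rw [← norm_iteratedFDeriv_one (𝕜 := ℝ)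
      (fderiv ℝ (radialCutoff 1 2 : EuclideanSpace ℝ (Fin 3) → ℝ)), norm_iteratedFDeriv_fderiv]
    exact hB₂ w
  have hsm₂' : ContDiff ℝ 1 (fderiv ℝ (radialCutoff 1 2 : EuclideanSpace ℝ (Fin 3) → ℝ)) :=
    hsm₂.fderiv_right (m := 1) (by norm_num)
  refine ⟨B₁, B₂, (norm_nonneg _).trans (hB₁ 0),
    (norm_nonneg (iteratedFDeriv ℝ 2 (radialCutoff 1 2 : EuclideanSpace ℝ (Fin 3) → ℝ) 0)).trans
      (hB₂ 0), hB₁, fun w w' => ?_⟩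
  -- mean value inequality for `∇θ₁` on the whole space
  exact convex_univ.norm_image_sub_le_of_norm_fderiv_le (𝕜 := ℝ)
    (fun x _ => (hsm₂'.differentiable one_ne_zero) x) (fun x _ => hB₂' x) (mem_univ w') (mem_univ w)

/-- The cutoff at scale `R` is the unit cutoff rescaled and translated:
`χ_R(y) = θ₁(R⁻¹ (y − x₀))`. [folklore] -/
theorem cutoffTools_suppCutoff_eq_scale (x₀ : EuclideanSpace ℝ (Fin 3)) {R : ℝ} (hR : 0 < R) :
    suppCutoff x₀ R = fun y => radialCutoff 1 2 (R⁻¹ • (y - x₀)) :=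
  funext fun y => radialCutoff_eps_eq_scale hR (y - x₀)

/-- **Chain rule for the rescaled cutoff**: `∇χ_R(y) = R⁻¹ ∇θ₁(R⁻¹(y − x₀))`. [folklore] -/
theorem cutoffTools_fderiv_suppCutoff (x₀ : EuclideanSpace ℝ (Fin 3)) {R : ℝ} (hR : 0 < R)
    (y : EuclideanSpace ℝ (Fin 3)) :
    fderiv ℝ (suppCutoff x₀ R) y =
      R⁻¹ • fderiv ℝ (radialCutoff 1 2 : EuclideanSpace ℝ (Fin 3) → ℝ) (R⁻¹ • (y - x₀)) := by
  have hsm : ContDiff ℝ 1 (radialCutoff 1 2 : EuclideanSpace ℝ (Fin 3) → ℝ) :=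
    radialCutoff_contDiff 1 2
  rw [cutoffTools_suppCutoff_eq_scale x₀ hR]
  have h1 : HasFDerivAt (fun y : EuclideanSpace ℝ (Fin 3) => R⁻¹ • (y - x₀))
      (R⁻¹ • ContinuousLinearMap.id ℝ (EuclideanSpace ℝ (Fin 3))) y :=
    (hasFDerivAt_sub_const x₀).const_smul R⁻¹
  have hd : DifferentiableAt ℝ (radialCutoff 1 2 : EuclideanSpace ℝ (Fin 3) → ℝ) (R⁻¹ • (y - x₀)) :=
    (hsm.differentiable one_ne_zero) _
  have h2 := hd.hasFDerivAt.comp y h1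
  have h3 : HasFDerivAt (fun y : EuclideanSpace ℝ (Fin 3) => radialCutoff 1 2 (R⁻¹ • (y - x₀)))
      ((fderiv ℝ (radialCutoff 1 2 : EuclideanSpace ℝ (Fin 3) → ℝ) (R⁻¹ • (y - x₀))).comp
        (R⁻¹ • ContinuousLinearMap.id ℝ (EuclideanSpace ℝ (Fin 3)))) y := h2
  rw [h3.fderiv]
  ext w
  simp

/-- **Scale-`R` calculus of the cutoff** (registered stub `stub_cutoffTools`): universal
`c₁, c₂ ≥ 0` with, for every centre `x₀` and every `R > 0`, `‖∇χ_R‖ ≤ c₁/R`, `χ_R`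
`(c₁/R)`-Lipschitz, `∇χ_R` `(c₂/R²)`-Lipschitz, and the same two bounds for the Riesz gradient
`gradient χ_R` (a linear isometric image of the Fréchet derivative) — Gilbarg–Trudinger, *Elliptic
PDE of Second Order* (2001), §4.1, cutoff with `|Dη| ≤ C/R`, `|D²η| ≤ C/R²`. [folklore] -/
theorem stub_cutoffTools : ∃ c₁ c₂ : ℝ, 0 ≤ c₁ ∧ 0 ≤ c₂ ∧ ∀ (x₀ : EuclideanSpace ℝ (Fin 3)) (R : ℝ), 0 < R → (∀ y, ‖fderiv ℝ (suppCutoff x₀ R) y‖ ≤ c₁ / R) ∧ (∀ y y', |suppCutoff x₀ R y - suppCutoff x₀ R y'| ≤ c₁ / R * ‖y - y'‖) ∧ (∀ y y', ‖fderiv ℝ (suppCutoff x₀ R) y - fderiv ℝ (suppCutoff x₀ R) y'‖ ≤ c₂ / R ^ 2 * ‖y - y'‖) ∧ (∀ y, ‖gradient (suppCutoff x₀ R) y‖ ≤ c₁ / R) ∧ (∀ y y', ‖gradient (suppCutoff x₀ R) y - gradient (suppCutoff x₀ R) y'‖ ≤ c₂ / R ^ 2 * ‖y - y'‖) := by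
  obtain ⟨B₁, B₂, hB₁0, hB₂0, hB₁, hB₂⟩ := cutoffTools_unitBounds
  refine ⟨B₁, B₂, hB₁0, hB₂0, fun x₀ R hR => ?_⟩
  -- the derivative bound at scale `R`
  have hD : ∀ y, ‖fderiv ℝ (suppCutoff x₀ R) y‖ ≤ B₁ / R := by
    intro y
    rw [cutoffTools_fderiv_suppCutoff x₀ hR y, norm_smul, norm_inv, Real.norm_eq_abs,
      abs_of_pos hR, div_eq_mul_inv, mul_comm]
    gcongr
    exact hB₁ _
  -- the Lipschitz bound for the derivative at scale `R`
  have hD₂ : ∀ y y', ‖fderiv ℝ (suppCutoff x₀ R) y - fderiv ℝ (suppCutoff x₀ R) y'‖ ≤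
      B₂ / R ^ 2 * ‖y - y'‖ := by
    intro y y'
    rw [cutoffTools_fderiv_suppCutoff x₀ hR y, cutoffTools_fderiv_suppCutoff x₀ hR y', ← smul_sub,
      norm_smul, norm_inv, Real.norm_eq_abs, abs_of_pos hR]
    have hdiff : R⁻¹ • (y - x₀) - R⁻¹ • (y' - x₀) = R⁻¹ • (y - y') := by
      rw [← smul_sub, sub_sub_sub_cancel_right]
    calc R⁻¹ * ‖fderiv ℝ (radialCutoff 1 2 : EuclideanSpace ℝ (Fin 3) → ℝ) (R⁻¹ • (y - x₀)) -
            fderiv ℝ (radialCutoff 1 2 : EuclideanSpace ℝ (Fin 3) → ℝ) (R⁻¹ • (y' - x₀))‖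
        ≤ R⁻¹ * (B₂ * ‖R⁻¹ • (y - x₀) - R⁻¹ • (y' - x₀)‖) := by gcongr; exact hB₂ _ _
      _ = B₂ / R ^ 2 * ‖y - y'‖ := by
        rw [hdiff, norm_smul, norm_inv, Real.norm_eq_abs, abs_of_pos hR]
        field_simp
  refine ⟨hD, fun y y' => ?_, hD₂, fun y => ?_, fun y y' => ?_⟩
  · -- Lipschitz bound for `χ_R` by the mean value inequality on the whole space
    rw [← Real.norm_eq_abs]
    exact convex_univ.norm_image_sub_le_of_norm_fderiv_le (𝕜 := ℝ)
      (fun x _ => ((contDiff_suppCutoff x₀ R (n := 1)).differentiable one_ne_zero) x)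
      (fun x _ => hD x) (mem_univ y') (mem_univ y)
  · -- the Riesz gradient has the norm of the Fréchet derivative
    rw [gradient, LinearIsometryEquiv.norm_map]
    exact hD y
  · rw [gradient, gradient, ← map_sub, LinearIsometryEquiv.norm_map]
    exact hD₂ y y'

end Summit.NavierStokesRegularity.NavierStokesRegularity.Theorems.BlobRiccatiClosure.TypeIApexLiouville

end
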